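import Summits.QuantumFields.YangMills.Theorems.FemtoCutoffLadderFixedLatticeLawOffTube
import Summits.QuantumFields.YangMills.Theorems.FemtoCutoffLadderFixedLatticeLawOfTube

/-!
# Crux `FixedLatticeLaw` (stmt-QuantumFields-23943 ≡ leaf `FemtoGapFixedLattice`) ⟸ K1 `NearFlatRatioLaw` ALONE (K2 is a theorem)

Seat `ym-line-fcl-p3` g2 (2026-08-28; explicit-unit prover of route `FemtoCutoffLadder`).  Rung R2b1 = RECORD-label femto transfer gap: NOT infinite
volume, NOT the Clay mass gap, no summit.

Cone leaf (imports the route file through the glue `femtoGapFixedLattice_of_nearFlat_offTube`; nothing imports this file): the planner's flat-tube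
split `FixedLatticeLaw ⇐ K1 ∧ K2` with K2 = `offTubeSuppression` (PROVED, `FemtoCutoffLadderFixedLatticeLawOffTube.lean`) discharged:

* ★★★ `femtoGapFixedLattice_of_nearFlat : K1 → FemtoGapFixedLattice`,
* ★★★ `fixedLatticeLaw_of_nearFlat : K1 → Theses.FemtoCutoffLadder.FixedLatticeLaw` (the item's decl BY NAME),

where K1 is the verbatim body of `Theses.FlatTubeReduction.NearFlatRatioLaw` (stmt-QuantumFields-24720): Born–Oppenheimer in the flat tube
`{S ≤ β^{−θ}}` at precision `λ_b²/L` against the one-site levels at coupling `L³β`.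
HONEST FRAMING: K1 is XL and OPEN (in print only for `L = 1`); `FixedLatticeLaw` stays open.  No definitions, no named facts, no `sorry`.
-/

set_option autoImplicit false

noncomputable section

open Literature.MathematicalPhysics.QuantumFieldTheory hiding SU2

namespace Summit.QuantumFields.YangMills.Theorems.FemtoCutoffLadder

open Summit.QuantumFields.YangMills.Theorems.FemtoTransferGap

/-- ★★★ **The fixed-lattice leaf from K1 alone**: `NearFlatRatioLaw` (stmt-QuantumFields-24720: Born–Oppenheimer in the flat tube, spelled out)
`⟹ FemtoGapFixedLattice` — K2 is `offTubeSuppression`. [cite: Luscher1983, §3] [cite: LuscherMunster1984, §2] -/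
theorem femtoGapFixedLattice_of_nearFlat
    (h₁ : ∀ (L : ℕ) [NeZero L], ∃ θ C β0 : ℝ, 0 < θ ∧ θ < 1 ∧ ∀ β : ℝ, β0 ≤ β → ∀ (Ω ψ :
      Literature.MathematicalPhysics.QuantumFieldTheory.GaugeConfig 3 L SU2 → ℝ), IsPhys Ω → (∀ U, 0 < Ω U) →
      transferApply β Ω = topValue su2Rep L β • Ω → IsPhys ψ → l2 ψ Ω = 0 → (∀ U, β ^ (-θ) <
      Literature.MathematicalPhysics.QuantumFieldTheory.wilsonAction su2Rep U → ψ U = 0) → qform su2Rep β ψ ψ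
      * levelValue su2Rep 1 ((L : ℝ) ^ 3 * β) 0 ≤ Real.exp (C * bareLambda β ^ 2 / L) * levelValue su2Rep 1
      ((L : ℝ) ^ 3 * β) 1 * topValue su2Rep L β * l2 ψ ψ) :
    FemtoGapFixedLattice :=
  femtoGapFixedLattice_of_nearFlat_offTube h₁ offTubeSuppression

/-- ★★★ **FCL's route decl BY NAME from K1 alone**: `NearFlatRatioLaw` (spelled out) `⟹ Theses.FemtoCutoffLadder.FixedLatticeLaw`
(stmt-QuantumFields-23943). [cite: Luscher1983, §3] [cite: LuscherMunster1984, §2] -/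
theorem fixedLatticeLaw_of_nearFlat
    (h₁ : ∀ (L : ℕ) [NeZero L], ∃ θ C β0 : ℝ, 0 < θ ∧ θ < 1 ∧ ∀ β : ℝ, β0 ≤ β → ∀ (Ω ψ :
      Literature.MathematicalPhysics.QuantumFieldTheory.GaugeConfig 3 L SU2 → ℝ), IsPhys Ω → (∀ U, 0 < Ω U) →
      transferApply β Ω = topValue su2Rep L β • Ω → IsPhys ψ → l2 ψ Ω = 0 → (∀ U, β ^ (-θ) <
      Literature.MathematicalPhysics.QuantumFieldTheory.wilsonAction su2Rep U → ψ U = 0) → qform su2Rep β ψ ψ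
      * levelValue su2Rep 1 ((L : ℝ) ^ 3 * β) 0 ≤ Real.exp (C * bareLambda β ^ 2 / L) * levelValue su2Rep 1
      ((L : ℝ) ^ 3 * β) 1 * topValue su2Rep L β * l2 ψ ψ) :
    Summit.QuantumFields.YangMills.Theses.FemtoCutoffLadder.FixedLatticeLaw :=
  femtoGapFixedLattice_of_nearFlat h₁

end Summit.QuantumFields.YangMills.Theorems.FemtoCutoffLadder

end
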